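import Summits.HodgeConjecture.CorCM.CMSixfoldRank.ValueClasses
import HarnessLib

/-!
# Rank of CM types on twelve embeddings, IV: three classes of size four force rank `≤ 4`

Fourth file of the proof that a primitive CM type on `12` embeddings has rank `≥ 6`
(`RankAtLeastSix.lean`).  If the classes of points with equal `M`-values (up to sign) have size four,
`E` (`|E| = 12`) is three classes `{v_j, v_j'} ⊔ ρ{v_j, v_j'}`; `Σ_Φ μ = Σ_j c_j μ(v_j)` with `c_j ∈ {0, ±2}`
vanishing iff `Φ` is MIXED at `j` (`v_j ∈ Φ ↔ v_j' ∉ Φ`), so all `c_j` vanish or none does (one- and two-term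
relations contradict the separation of the classes); a translate `g⁻¹Φ` is pure at `j` iff `Φ` is pure at the
class of `g v_j`; primitivity separates `v₁ ≠ v₁'` by some translate, which is mixed at `1`, so `Φ` is mixed
somewhere, hence everywhere, hence so is every translate — and the three weights `δ_j` are balanced,
anti-invariant, orthogonal and non-zero, whence `rank + 3 ≤ 7` (`typeRank_add_card_le_of_orthogonal`).
Everything PROVED; no definition, no named fact.

## References (held texts)

* B. Dodson, *On the Mumford–Tate group of an abelian variety with complex multiplication*, J. Algebra 111 (1987)
  [Dodson1987] (`paper:doi-10-1016-0021-8693-87-90242-0`), p0003 Thm. 1.0, Thm. 1.4; p0004 Cor. 1.5.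
* T. Kubota, Trans. AMS 118 (1965) [Kubota1965], §4 (defect).  K. A. Ribet, Mém. SMF 2 (1980) [Ribet1980], §3 (3.5).
* B. B. Gordon, *A survey of the Hodge conjecture for abelian varieties* [Gordon1999HodgeAVSurvey], §9.2 (9.2.1), 9.4.
-/

noncomputable section

open scoped BigOperators Pointwise Classical

namespace Summit.HodgeConjecture.CorCM.CMSixfoldRank

open Literature.NumberTheory.ComplexMultiplication
open Literature.NumberTheory.ComplexMultiplication.IsCMTypeWith

variable {G : Type*} [Group G] {E : Type*} [MulAction G E]

variable {ρ : G} {Φ : Set E} (h : IsCMTypeWith ρ Φ)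
include h


section NonSeparating

variable {V : Type*} [AddCommGroup V] [Module ℚ V]

/-- **Three classes of size four force `rank ≤ 4`** (given primitivity).  With fibres `{v_j, v_j'}`,
`j = 1, 2, 3`: `Σ_Φ μ = Σ_j c_j μ(v_j)`, `c_j ∈ {0, ±2}` vanishing iff `Φ` is mixed at `j`; all `c_j` vanish or
none does; primitivity separates `v₁ ≠ v₁'`, so not all pairs are pure, so all are mixed, for every translate
too — and the three weights `δ_j` are balanced, anti-invariant, orthogonal and non-zero: `rank + 3 ≤ 7`. [folklore] -/
theorem typeRank_le_four_of_card_fibre_eq_two [Fintype E] [MulAction.IsPretransitive G E]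
    (M : Submodule ℚ (E → ℚ)) (hMa : ∀ μ ∈ M, ∀ x, μ (ρ • x) = -μ x)
    (o : E → V) (ho : ∀ x y, o x = o y ↔ ∀ μ ∈ M, μ x = μ y) (hoρ : ∀ x, o (ρ • x) = -o x)
    (ho0 : ∀ x, o x ≠ 0) (hoG : ∀ (g : G) (x y : E), o (g • x) = o (g • y) ↔ o x = o y)
    (F : E → Finset E) (hF : ∀ x y, y ∈ F x ↔ o y = o x) (hcard : Fintype.card E = 12)
    (hΦnull : ∀ μ ∈ M, ∑ y ∈ Finset.univ.filter (fun y : E => y ∈ Φ), μ y = 0)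
    (hsep : ∀ x y : E, (∀ g : G, g • x ∈ Φ ↔ g • y ∈ Φ) → x = y)
    {x₁ z : E} (hz : o z ≠ o x₁) (hz' : o z ≠ -o x₁) (hs : (F x₁).card = 2) : typeRank G Φ ≤ 4 := by
  haveI : Nonempty E := ⟨x₁⟩
  have hoM : ∀ x y, o y = o x → ∀ μ ∈ M, μ y = μ x := fun x y hxy => (ho y x).1 hxy
  have hsF : ∀ x, (F x).card = 2 := fun x => by rw [card_fibre_eq o hoG F hF x₁ x, hs]
  have hcC : ∀ x, (F x ∪ F (ρ • x)).card = 4 := fun x => by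
    rw [card_union_fibre h o hoρ ho0 F hF, hsF]
  have hdisj₁ : Disjoint (F z ∪ F (ρ • z)) (F x₁ ∪ F (ρ • x₁)) := disjoint_union_fibre o hoρ F hF hz hz'
  -- a third class
  obtain ⟨w, hwC⟩ : ∃ w, w ∉ (F z ∪ F (ρ • z)) ∪ (F x₁ ∪ F (ρ • x₁)) := by
    by_contra hall
    push Not at hall
    have hu : (F z ∪ F (ρ • z)) ∪ (F x₁ ∪ F (ρ • x₁)) = Finset.univ := Finset.eq_univ_of_forall hall
    have h1 := congrArg Finset.card hu
    rw [Finset.card_union_of_disjoint hdisj₁, hcC, hcC, Finset.card_univ, hcard] at h1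
    omega
  have hw : (o w ≠ o z ∧ o w ≠ -o z) ∧ (o w ≠ o x₁ ∧ o w ≠ -o x₁) := by
    rw [Finset.mem_union, mem_union_fibre_iff o hoρ F hF, mem_union_fibre_iff o hoρ F hF] at hwC
    push Not at hwC
    exact hwC
  have hdisj₂ : Disjoint (F w ∪ F (ρ • w)) (F z ∪ F (ρ • z)) :=
    disjoint_union_fibre o hoρ F hF hw.1.1 hw.1.2
  have hdisj₃ : Disjoint (F w ∪ F (ρ • w)) (F x₁ ∪ F (ρ • x₁)) :=
    disjoint_union_fibre o hoρ F hF hw.2.1 hw.2.2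
  have hdisj₂₃ : Disjoint (F w ∪ F (ρ • w)) ((F z ∪ F (ρ • z)) ∪ (F x₁ ∪ F (ρ • x₁))) :=
    Finset.disjoint_union_right.2 ⟨hdisj₂, hdisj₃⟩
  have huniv : (F w ∪ F (ρ • w)) ∪ ((F z ∪ F (ρ • z)) ∪ (F x₁ ∪ F (ρ • x₁))) = Finset.univ :=
    Finset.eq_univ_of_card _ (by
      rw [Finset.card_union_of_disjoint hdisj₂₃, Finset.card_union_of_disjoint hdisj₁, hcC, hcC, hcC,
        hcard])
  have hval : ∀ y, (o y = o w ∨ o y = -o w) ∨ ((o y = o z ∨ o y = -o z) ∨ (o y = o x₁ ∨ o y = -o x₁)) := by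
    intro y
    have hy : y ∈ (F w ∪ F (ρ • w)) ∪ ((F z ∪ F (ρ • z)) ∪ (F x₁ ∪ F (ρ • x₁))) :=
      huniv ▸ Finset.mem_univ y
    rw [Finset.mem_union, mem_union_fibre_iff o hoρ F hF, Finset.mem_union, mem_union_fibre_iff o hoρ F hF,
      mem_union_fibre_iff o hoρ F hF] at hy
    exact hy
  -- partners
  obtain ⟨x₁', hx₁ne, hFx₁⟩ := exists_partner ((hF x₁ x₁).2 rfl) (hsF x₁)
  obtain ⟨z', hzne, hFz⟩ := exists_partner ((hF z z).2 rfl) (hsF z)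
  obtain ⟨w', hwne, hFw⟩ := exists_partner ((hF w w).2 rfl) (hsF w)
  have hFeq : ∀ x y, o y = o x → F y = F x := fun x y hxy => by
    ext u; rw [hF, hF, hxy]
  have hFeq' : ∀ x y, o y = -o x → F y = F (ρ • x) := fun x y hxy =>
    hFeq (ρ • x) y (by rw [hoρ]; exact hxy)
  have hFy : ∀ y, (F y = F w ∨ F y = F (ρ • w)) ∨
      ((F y = F z ∨ F y = F (ρ • z)) ∨ (F y = F x₁ ∨ F y = F (ρ • x₁))) := by
    intro y
    rcases hval y with (hy | hy) | ((hy | hy) | (hy | hy))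
    · exact Or.inl (Or.inl (hFeq w y hy))
    · exact Or.inl (Or.inr (hFeq' w y hy))
    · exact Or.inr (Or.inl (Or.inl (hFeq z y hy)))
    · exact Or.inr (Or.inl (Or.inr (hFeq' z y hy)))
    · exact Or.inr (Or.inr (Or.inl (hFeq x₁ y hy)))
    · exact Or.inr (Or.inr (Or.inr (hFeq' x₁ y hy)))
  -- purity of a fibre
  have hPpair : ∀ {v v' : E}, F v = {v, v'} →
      ((∀ u ∈ F v, ∀ u' ∈ F v, (u ∈ Φ ↔ u' ∈ Φ)) ↔ (v ∈ Φ ↔ v' ∈ Φ)) := by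
    intro v v' hFv
    rw [hFv]
    constructor
    · intro hP; exact hP v (by simp) v' (by simp)
    · intro hvv u hu u' hu'
      simp only [Finset.mem_insert, Finset.mem_singleton] at hu hu'
      rcases hu with rfl | rfl <;> rcases hu' with rfl | rfl
      · exact Iff.rfl
      · exact hvv
      · exact hvv.symm
      · exact Iff.rfl
  have hPrho : ∀ v : E, (∀ u ∈ F (ρ • v), ∀ u' ∈ F (ρ • v), (u ∈ Φ ↔ u' ∈ Φ)) ↔
      (∀ u ∈ F v, ∀ u' ∈ F v, (u ∈ Φ ↔ u' ∈ Φ)) := by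
    intro v
    rw [fibre_rho h o hoρ F hF v]
    constructor
    · intro hP a ha b hb
      have h1 := hP (ρ • a) (Finset.mem_image_of_mem _ ha) (ρ • b) (Finset.mem_image_of_mem _ hb)
      rw [h.rho_smul_mem_iff, h.rho_smul_mem_iff] at h1
      exact not_iff_not.1 h1
    · intro hP a ha b hb
      obtain ⟨a₀, ha₀, rfl⟩ := Finset.mem_image.1 ha
      obtain ⟨b₀, hb₀, rfl⟩ := Finset.mem_image.1 hb
      rw [h.rho_smul_mem_iff, h.rho_smul_mem_iff]
      exact not_iff_not.2 (hP a₀ ha₀ b₀ hb₀)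
  have hPy : ∀ y, (∀ u ∈ F y, ∀ u' ∈ F y, (u ∈ Φ ↔ u' ∈ Φ)) →
      ((w ∈ Φ ↔ w' ∈ Φ) ∨ (z ∈ Φ ↔ z' ∈ Φ) ∨ (x₁ ∈ Φ ↔ x₁' ∈ Φ)) := by
    intro y hP
    rcases hFy y with (hy | hy) | ((hy | hy) | (hy | hy)) <;> rw [hy] at hP
    · exact Or.inl ((hPpair hFw).1 hP)
    · exact Or.inl ((hPpair hFw).1 ((hPrho w).1 hP))
    · exact Or.inr (Or.inl ((hPpair hFz).1 hP))
    · exact Or.inr (Or.inl ((hPpair hFz).1 ((hPrho z).1 hP)))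
    · exact Or.inr (Or.inr ((hPpair hFx₁).1 hP))
    · exact Or.inr (Or.inr ((hPpair hFx₁).1 ((hPrho x₁).1 hP)))
  have hFg : ∀ {v v' : E}, F v = {v, v'} → ∀ g : G, F (g • v) = {g • v, g • v'} := by
    intro v v' hFv g
    rw [fibre_smul o hoG F hF g v, hFv, Finset.image_insert, Finset.image_singleton]
  -- the three-term relation from `Σ_Φ μ = 0`
  have hrel : ∀ μ ∈ M,
      ((if w ∈ Φ then (1 : ℚ) else -1) + (if w' ∈ Φ then 1 else -1)) * μ w +
      (((if z ∈ Φ then (1 : ℚ) else -1) + (if z' ∈ Φ then 1 else -1)) * μ z +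
      ((if x₁ ∈ Φ then (1 : ℚ) else -1) + (if x₁' ∈ Φ then 1 else -1)) * μ x₁) = 0 := by
    intro μ hμ
    have h0 := hΦnull μ hμ
    rw [Finset.sum_filter, ← huniv, Finset.sum_union hdisj₂₃, Finset.sum_union hdisj₁,
      sum_class_pair h M hMa o hoM hoρ ho0 F hF hwne hFw hμ,
      sum_class_pair h M hMa o hoM hoρ ho0 F hF hzne hFz hμ,
      sum_class_pair h M hMa o hoM hoρ ho0 F hF hx₁ne hFx₁ hμ] at h0
    exact h0
  obtain ⟨hcw3, hcw0⟩ := pair_coeff_cases (Φ := Φ) w w'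
  obtain ⟨hcz3, hcz0⟩ := pair_coeff_cases (Φ := Φ) z z'
  obtain ⟨hcx3, hcx0⟩ := pair_coeff_cases (Φ := Φ) x₁ x₁'
  set cw := (if w ∈ Φ then (1 : ℚ) else -1) + (if w' ∈ Φ then 1 else -1) with hcw
  set cz := (if z ∈ Φ then (1 : ℚ) else -1) + (if z' ∈ Φ then 1 else -1) with hcz
  set cx := (if x₁ ∈ Φ then (1 : ℚ) else -1) + (if x₁' ∈ Φ then 1 else -1) with hcx
  have hne2 : ∀ {c : ℚ}, (c = 2 ∨ c = -2 ∨ c = 0) → c ≠ 0 → (c = 2 ∨ c = -2) := by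
    intro c hc hc0
    rcases hc with hc | hc | hc
    · exact Or.inl hc
    · exact Or.inr hc
    · exact absurd hc hc0
  -- all coefficients vanish or none does
  have hall : (cw = 0 ∧ cz = 0 ∧ cx = 0) ∨ (cw ≠ 0 ∧ cz ≠ 0 ∧ cx ≠ 0) := by
    by_cases h1 : cw = 0 <;> by_cases h2 : cz = 0 <;> by_cases h3 : cx = 0
    · exact Or.inl ⟨h1, h2, h3⟩
    · exfalso
      refine false_of_one_term M hMa o ho hoρ ho0 (a := x₁) h3 fun μ hμ => ?_
      have h' := hrel μ hμ
      rw [h1, h2] at h'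
      linarith
    · exfalso
      refine false_of_one_term M hMa o ho hoρ ho0 (a := z) h2 fun μ hμ => ?_
      have h' := hrel μ hμ
      rw [h1, h3] at h'
      linarith
    · exfalso
      rcases eq_or_eq_neg_of_two_term M hMa o ho hoρ (a := z) (b := x₁) (hne2 hcz3 h2) (hne2 hcx3 h3)
          (fun μ hμ => by have h' := hrel μ hμ; rw [h1] at h'; linarith) with h' | h'
      · exact hz h'
      · exact hz' h'
    · exfalso
      refine false_of_one_term M hMa o ho hoρ ho0 (a := w) h1 fun μ hμ => ?_
      have h' := hrel μ hμ
      rw [h2, h3] at h'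
      linarith
    · exfalso
      rcases eq_or_eq_neg_of_two_term M hMa o ho hoρ (a := w) (b := x₁) (hne2 hcw3 h1) (hne2 hcx3 h3)
          (fun μ hμ => by have h' := hrel μ hμ; rw [h2] at h'; linarith) with h' | h'
      · exact hw.2.1 h'
      · exact hw.2.2 h'
    · exfalso
      rcases eq_or_eq_neg_of_two_term M hMa o ho hoρ (a := w) (b := z) (hne2 hcw3 h1) (hne2 hcz3 h2)
          (fun μ hμ => by have h' := hrel μ hμ; rw [h3] at h'; linarith) with h' | h'
      · exact hw.1.1 h'
      · exact hw.1.2 h'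
    · exact Or.inr ⟨h1, h2, h3⟩
  -- primitivity: not all three base pairs are pure
  have hnotall : ¬ (cw ≠ 0 ∧ cz ≠ 0 ∧ cx ≠ 0) := by
    rintro ⟨h1, h2, h3⟩
    have hpw : (w ∈ Φ ↔ w' ∈ Φ) := by by_contra h'; exact h1 (hcw0.2 h')
    have hpz : (z ∈ Φ ↔ z' ∈ Φ) := by by_contra h'; exact h2 (hcz0.2 h')
    have hpx : (x₁ ∈ Φ ↔ x₁' ∈ Φ) := by by_contra h'; exact h3 (hcx0.2 h')
    apply hx₁ne
    apply hsep x₁ x₁'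
    intro g
    have hP : ∀ u ∈ F (g • x₁), ∀ u' ∈ F (g • x₁), (u ∈ Φ ↔ u' ∈ Φ) := by
      rcases hFy (g • x₁) with (hy | hy) | ((hy | hy) | (hy | hy)) <;> rw [hy]
      · exact (hPpair hFw).2 hpw
      · exact (hPrho w).2 ((hPpair hFw).2 hpw)
      · exact (hPpair hFz).2 hpz
      · exact (hPrho z).2 ((hPpair hFz).2 hpz)
      · exact (hPpair hFx₁).2 hpx
      · exact (hPrho x₁).2 ((hPpair hFx₁).2 hpx)
    exact (hPpair (hFg hFx₁ g)).1 hP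
  have h0 : cw = 0 ∧ cz = 0 ∧ cx = 0 := hall.resolve_right hnotall
  have hmw : ¬ (w ∈ Φ ↔ w' ∈ Φ) := hcw0.1 h0.1
  have hmz : ¬ (z ∈ Φ ↔ z' ∈ Φ) := hcz0.1 h0.2.1
  have hmx : ¬ (x₁ ∈ Φ ↔ x₁' ∈ Φ) := hcx0.1 h0.2.2
  have hM' : ∀ y, ¬ (∀ u ∈ F y, ∀ u' ∈ F y, (u ∈ Φ ↔ u' ∈ Φ)) := by
    intro y hP
    rcases hPy y hP with h' | h' | h'
    · exact hmw h'
    · exact hmz h'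
    · exact hmx h'
  have hmixg : ∀ {v v' : E}, F v = {v, v'} → ∀ g : G, ¬ (g • v ∈ Φ ↔ g • v' ∈ Φ) := by
    intro v v' hFv g hiff
    exact hM' (g • v) ((hPpair (hFg hFv g)).2 hiff)
  -- the three balanced weights
  have hC : ∀ {v v' : E}, F v = {v, v'} → F v ∪ F (ρ • v) = ({v, v', ρ • v, ρ • v'} : Finset E) := by
    intro v v' hFv
    rw [fibre_rho h o hoρ F hF v, hFv, Finset.image_insert, Finset.image_singleton]
    ext y
    simp only [Finset.mem_union, Finset.mem_insert, Finset.mem_singleton, or_assoc]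
  have hne3 : ∀ {v v' : E}, v ≠ v' → F v = {v, v'} →
      (fun y => (if y = v then (1 : ℚ) else 0) + (if y = v' then 1 else 0) -
        (if y = ρ • v then 1 else 0) - (if y = ρ • v' then 1 else 0)) ≠ 0 := by
    intro v v' hvv hFv
    refine delta_ne_zero hvv (h.rho_smul_ne v).symm fun hv => ?_
    have h1 : o v' = o v := (hF v v').1 (by rw [hFv]; simp)
    have e := congrArg o hv
    rw [hoρ, h1] at e
    exact apply_ne_neg_apply o ho0 v e
  rw [hC hFw, hC hFz] at hdisj₂
  rw [hC hFw, hC hFx₁] at hdisj₃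
  rw [hC hFz, hC hFx₁] at hdisj₁
  have key := h.typeRank_add_card_le_of_orthogonal
    ![fun y => (if y = w then (1 : ℚ) else 0) + (if y = w' then 1 else 0) -
        (if y = ρ • w then 1 else 0) - (if y = ρ • w' then 1 else 0),
      fun y => (if y = z then (1 : ℚ) else 0) + (if y = z' then 1 else 0) -
        (if y = ρ • z then 1 else 0) - (if y = ρ • z' then 1 else 0),
      fun y => (if y = x₁ then (1 : ℚ) else 0) + (if y = x₁' then 1 else 0) -
        (if y = ρ • x₁ then 1 else 0) - (if y = ρ • x₁' then 1 else 0)]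
    (by
      intro i
      fin_cases i
      · exact isBalanced_delta h w w' (hmixg hFw)
      · exact isBalanced_delta h z z' (hmixg hFz)
      · exact isBalanced_delta h x₁ x₁' (hmixg hFx₁))
    (by
      intro i y
      fin_cases i
      · exact delta_rho_smul h w w' y
      · exact delta_rho_smul h z z' y
      · exact delta_rho_smul h x₁ x₁' y)
    (by
      intro i i' hii'
      fin_cases i <;> fin_cases i'
      · exact absurd rfl hii'
      · exact dotProduct_delta_eq_zero hdisj₂
      · exact dotProduct_delta_eq_zero hdisj₃
      · exact dotProduct_delta_eq_zero hdisj₂.symm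
      · exact absurd rfl hii'
      · exact dotProduct_delta_eq_zero hdisj₁
      · exact dotProduct_delta_eq_zero hdisj₃.symm
      · exact dotProduct_delta_eq_zero hdisj₁.symm
      · exact absurd rfl hii')
    (by
      intro i
      fin_cases i
      · exact hne3 hwne hFw
      · exact hne3 hzne hFz
      · exact hne3 hx₁ne hFx₁)
  rw [Fintype.card_fin, hcard] at key
  omega

end NonSeparating

end Summit.HodgeConjecture.CorCM.CMSixfoldRank

end
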